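import Summits.CriticalPhenomena.PercolationContinuityZ3.Theorems.PercNearOneGluingNoHeavyPcintMemUniformTenData
import HarnessLib

/-!
# CriticalPhenomena/PercolationContinuityZ3 — Theorems/PercNearOneGluingNoHeavyPcintMemUniformTenStructB.lean: fast structural check of rows 1536–3071 of the memory-10 list (kernel)

Lane prim-pcint, STRUCTURE rule (prim-pcint-2 GEN 19).  `URowsOKF u10tab 10 6192 lo 192 = true` for the 192-row ranges of rows 1536–3071, each by one
`decide +kernel` (tuple-model check of …MemUniformChunkFast: every recorded successor is `mstep 10` of the row state up to the recorded
symmetry, indices `< 6192`), assembled as `structRows10B : URowsOKC perm6 u10tab 10 6192 1536 3072` by `urowsOKC_of_fast` + `permsOK_perm6`.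
Generated by numerics/emit_u10struct.py.

HONEST FRAMING: kernel evaluation of a finite check.  No `sorry`; standard axioms.  Written by prim-pcint-2 gen 19, 2026-08-26.
-/

namespace Summit.CriticalPhenomena.PercolationContinuityZ3.Theorems.Pcint

open Literature.Probability.Percolation Literature.Probability.LatticeModels

/-- Fast structural check of rows 1536–1727. [folklore] -/
theorem struct10_8 : URowsOKF u10tab 10 6192 1536 192 = true := by
  decide +kernel

/-- Fast structural check of rows 1728–1919. [folklore] -/
theorem struct10_9 : URowsOKF u10tab 10 6192 1728 192 = true := by
  decide +kernel

/-- Fast structural check of rows 1920–2111. [folklore] -/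
theorem struct10_10 : URowsOKF u10tab 10 6192 1920 192 = true := by
  decide +kernel

/-- Fast structural check of rows 2112–2303. [folklore] -/
theorem struct10_11 : URowsOKF u10tab 10 6192 2112 192 = true := by
  decide +kernel

/-- Fast structural check of rows 2304–2495. [folklore] -/
theorem struct10_12 : URowsOKF u10tab 10 6192 2304 192 = true := by
  decide +kernel

/-- Fast structural check of rows 2496–2687. [folklore] -/
theorem struct10_13 : URowsOKF u10tab 10 6192 2496 192 = true := by
  decide +kernel

/-- Fast structural check of rows 2688–2879. [folklore] -/
theorem struct10_14 : URowsOKF u10tab 10 6192 2688 192 = true := by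
  decide +kernel

/-- Fast structural check of rows 2880–3071. [folklore] -/
theorem struct10_15 : URowsOKF u10tab 10 6192 2880 192 = true := by
  decide +kernel

/-- **Rows 1536–3071 of the memory-10 list are structurally valid.** [folklore] -/
theorem structRows10B : URowsOKC perm6 u10tab 10 6192 1536 3072 :=
  (urowsOKC_append perm6 u10tab (urowsOKC_append perm6 u10tab (urowsOKC_append perm6 u10tab (urowsOKC_append perm6 u10tab (urowsOKC_append perm6 u10tab (urowsOKC_append perm6 u10tab (urowsOKC_append perm6 u10tab (urowsOKC_of_fast u10tab permsOK_perm6 struct10_8) (urowsOKC_of_fast u10tab permsOK_perm6 struct10_9)) (urowsOKC_of_fast u10tab permsOK_perm6 struct10_10)) (urowsOKC_of_fast u10tab permsOK_perm6 struct10_11)) (urowsOKC_of_fast u10tab permsOK_perm6 struct10_12)) (urowsOKC_of_fast u10tab permsOK_perm6 struct10_13)) (urowsOKC_of_fast u10tab permsOK_perm6 struct10_14)) (urowsOKC_of_fast u10tab permsOK_perm6 struct10_15))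

end Summit.CriticalPhenomena.PercolationContinuityZ3.Theorems.Pcint
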